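import Summits.QuantumFields.BalabanUV.T4Continuum.Support.NE7LongitudinalLineLift
import HarnessLib

/-!
# NE7LongitudinalLineLiftEnergy — THE L² BOUND OF THE LONGITUDINAL LIFT: `Σ_{y∈[0,MN)^d} ‖llift M N κ F y‖² ≤ 1154·(1/M)²·Σ_y ‖F y‖²`

Lineage `b2b-balaban-t4-ne7-p1` (CRUX PROVER NE7 #1 = OWNER of BINDER row NE7), generation 116 — fourth brick of the UNIFORM UPPER BOUND for the flat-background
effective quadratic form (ROAD-G116 §6(U)); sequel of ✓ `NE7LongitudinalLineLift` (`llift F = ∂_κ(clift M κ U) + M⁻¹ • m̂ F`, `U` the periodic coarse primitive of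
`F − m̂ F`).  WHAT ([folklore]; 0 def, 0 sorry): `normSq_mean_le` (Jensen for a finite mean), `sum_normSq_tmean_le` (`Σ ‖m̂ F‖² ≤ Σ ‖F‖²` over the period box),
**`sum_normSq_llift_le`**: for `F` `MN`-periodic and blockwise constant in `κ` (`M, N ≥ 1`), `Σ_{y∈[0,MN)^d} ‖llift F y‖² ≤ 1154·(1/M)²·Σ_y ‖F y‖²` — from the
H¹-stability `144/M²` of `clift` (✓ `NE7CoordinateBlockMeanLift.sum_normSq_step_clift_le`) applied to `U` (whose coarse differences are `F − m̂ F`) and Jensen.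
HONEST FRAMING: pure lattice calculus (kinematics of block averaging); nothing about Bałaban's minimisers; NOT NE7 as a spine node; spine 0∕9; NOT infinite volume,
NOT mass gap, NOT BetaPertH, NOT Clay.
-/

set_option autoImplicit false

open scoped BigOperators
open Finset

namespace Summit.QuantumFields.BalabanUV.T4Continuum.NE7LongitudinalLineLiftEnergy

open Literature.MathematicalPhysics.QuantumFieldTheory.Balaban1983to89
open B7Prop1Explicit
open T4AveragingDeficitWallBoundary (periodBox mem_periodBox sum_periodBox_shift)
open SmoothRefineBlocks (blk res blk_add_res res_nonneg res_lt blk_res_eq_of blk_res_add_period res_add_e_self res_add_e_ne)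
open NE7CoordinateLiftWeights
open NE7CoordinateBlockMeanLift
open NE7LongitudinalLineLift

noncomputable section

variable {d : ℕ}

/-! ## §4 The L² bound -/

section Energy

variable {X : Type*} [NormedAddCommGroup X] [NormedSpace ℝ X]

/-- Jensen for a finite mean: `‖N⁻¹ • Σ_{k<N} v_k‖² ≤ N⁻¹ Σ_{k<N} ‖v_k‖²` (`N ≥ 1`). [folklore] -/
theorem normSq_mean_le {N : ℕ} (hN : 1 ≤ N) (v : ℕ → X) :
    ‖(N : ℝ)⁻¹ • ∑ k ∈ range N, v k‖ ^ 2 ≤ (N : ℝ)⁻¹ * ∑ k ∈ range N, ‖v k‖ ^ 2 := by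
  have hNpos : (0 : ℝ) < N := by exact_mod_cast (by omega : 0 < N)
  have h1 : ‖∑ k ∈ range N, v k‖ ^ 2 ≤ (N : ℝ) * ∑ k ∈ range N, ‖v k‖ ^ 2 := by
    calc ‖∑ k ∈ range N, v k‖ ^ 2 ≤ (∑ k ∈ range N, ‖v k‖) ^ 2 := by gcongr; exact norm_sum_le _ _
      _ ≤ #(range N) * ∑ k ∈ range N, ‖v k‖ ^ 2 := sq_sum_le_card_mul_sum_sq
      _ = (N : ℝ) * ∑ k ∈ range N, ‖v k‖ ^ 2 := by rw [Finset.card_range]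
  rw [norm_smul, mul_pow, Real.norm_eq_abs, abs_inv, abs_of_pos hNpos, inv_pow]
  calc ((N : ℝ) ^ 2)⁻¹ * ‖∑ k ∈ range N, v k‖ ^ 2 ≤ ((N : ℝ) ^ 2)⁻¹ * ((N : ℝ) * ∑ k ∈ range N, ‖v k‖ ^ 2) := by gcongr
    _ = (N : ℝ)⁻¹ * ∑ k ∈ range N, ‖v k‖ ^ 2 := by field_simp

/-- `Σ_{y∈[0,MN)^d} ‖m̂ F y‖² ≤ Σ_y ‖F y‖²` for `F` `MN`-periodic. [folklore] -/
theorem sum_normSq_tmean_le {M N : ℕ} (hM : 1 ≤ M) (hN : 1 ≤ N) (κ : Fin d) {F : Site d → X}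
    (hFP : ∀ (y : Site d) (μ : Fin d), F (y + ((M * N : ℕ) : ℤ) • e μ) = F y) :
    ∑ y ∈ periodBox (d := d) (M * N), ‖tmean M N κ F y‖ ^ 2 ≤ ∑ y ∈ periodBox (d := d) (M * N), ‖F y‖ ^ 2 := by
  have hP : 1 ≤ M * N := Nat.one_le_iff_ne_zero.mpr (Nat.mul_ne_zero (by omega) (by omega))
  have hN0 : (N : ℝ) ≠ 0 := by exact_mod_cast (by omega : N ≠ 0)
  have hg : ∀ (x : Site d) (μ : Fin d), (fun y => ‖F y‖ ^ 2) (x + ((M * N : ℕ) : ℤ) • e μ) = (fun y => ‖F y‖ ^ 2) x := fun x μ => by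
    simp only [hFP]
  calc ∑ y ∈ periodBox (d := d) (M * N), ‖tmean M N κ F y‖ ^ 2
      ≤ ∑ y ∈ periodBox (d := d) (M * N), (N : ℝ)⁻¹ * ∑ k ∈ range N, ‖F (y + ((M : ℤ) * (k : ℤ)) • e κ)‖ ^ 2 :=
        Finset.sum_le_sum fun y _ => normSq_mean_le hN _
    _ = (N : ℝ)⁻¹ * ∑ k ∈ range N, ∑ y ∈ periodBox (d := d) (M * N), ‖F (y + ((M : ℤ) * (k : ℤ)) • e κ)‖ ^ 2 := by
        rw [← Finset.mul_sum, Finset.sum_comm]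
    _ = (N : ℝ)⁻¹ * ∑ k ∈ range N, ∑ y ∈ periodBox (d := d) (M * N), ‖F y‖ ^ 2 := by
        congr 1
        exact Finset.sum_congr rfl fun k _ => sum_periodBox_shift (M * N) hP (g := fun y => ‖F y‖ ^ 2) hg _
    _ = ∑ y ∈ periodBox (d := d) (M * N), ‖F y‖ ^ 2 := by
        rw [Finset.sum_const, Finset.card_range, nsmul_eq_mul, ← mul_assoc, inv_mul_cancel₀ hN0, one_mul]

/-- **THE L² BOUND**: for `F` `MN`-periodic and blockwise constant in `κ` (`M, N ≥ 1`),
`Σ_{y∈[0,MN)^d} ‖llift F y‖² ≤ 1154·(1/M)²·Σ_y ‖F y‖²`. [folklore] -/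
theorem sum_normSq_llift_le {M N : ℕ} (hM : 1 ≤ M) (hN : 1 ≤ N) (κ : Fin d) {F : Site d → X}
    (hFP : ∀ (y : Site d) (μ : Fin d), F (y + ((M * N : ℕ) : ℤ) • e μ) = F y) (hFB : ∀ y, F y = F (y - (res M y κ) • e κ)) :
    ∑ y ∈ periodBox (d := d) (M * N), ‖llift M N κ F y‖ ^ 2 ≤ 1154 * (1 / (M : ℝ)) ^ 2 * ∑ y ∈ periodBox (d := d) (M * N), ‖F y‖ ^ 2 := by
  have hP : 1 ≤ M * N := Nat.one_le_iff_ne_zero.mpr (Nat.mul_ne_zero (by omega) (by omega))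
  have hMN : ((M * N : ℕ) : ℤ) = (M : ℤ) * (N : ℤ) := by push_cast; ring
  have hF : ∀ y, F (y + ((M : ℤ) * (N : ℤ)) • e κ) = F y := fun y => by rw [← hMN]; exact hFP y κ
  set G : Site d → X := F - tmean M N κ F with hGdef
  set U : Site d → X := tprim M N κ G with hUdef
  have hGB : ∀ w, G w = G (w - (res M w κ) • e κ) := fun w => by
    simp only [hGdef, Pi.sub_apply]; rw [← hFB, ← tmean_bconst hM N κ hFB]
  have hUB : ∀ w, U w = U (w - (res M w κ) • e κ) := tprim_bconst hM N κ hGB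
  have hGP : ∀ w, G (w + ((M : ℤ) * (N : ℤ)) • e κ) = G w := fun w => by
    simp only [hGdef, Pi.sub_apply, hF, tmean_shift_mul κ hF w N]
  have hUstep : ∀ w, U (w + (M : ℤ) • e κ) - U w = G w := tprim_step hN κ hGP (sum_translates_sub_tmean hN κ hF)
  -- periodicity of `m̂ F`, `G`, `U` in every direction
  have hTP : ∀ (w : Site d) (μ : Fin d), tmean M N κ F (w + ((M * N : ℕ) : ℤ) • e μ) = tmean M N κ F w := fun w μ => by
    have h := congr_fun (tmean_translate M N κ F (((M * N : ℕ) : ℤ) • e μ)) w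
    rw [← h]
    simp only [hFP]
  have hGP' : ∀ (w : Site d) (μ : Fin d), G (w + ((M * N : ℕ) : ℤ) • e μ) = G w := fun w μ => by
    simp only [hGdef, Pi.sub_apply, hFP, hTP]
  have hUP : ∀ (w : Site d) (μ : Fin d), U (w + ((M * N : ℕ) : ℤ) • e μ) = U w := fun w μ => by
    have h := congr_fun (tprim_translate M N κ G (((M * N : ℕ) : ℤ) • e μ)) w
    rw [hUdef, ← h]
    have : (fun y => G (y + ((M * N : ℕ) : ℤ) • e μ)) = G := funext fun x => hGP' x μ
    rw [this]
  -- the three pieces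
  have h1 : ∑ y ∈ periodBox (d := d) (M * N), ‖clift M κ U (y + e κ) - clift M κ U y‖ ^ 2
      ≤ 144 * (1 / (M : ℝ)) ^ 2 * ∑ y ∈ periodBox (d := d) (M * N), ‖G y‖ ^ 2 := by
    have h := sum_normSq_step_clift_le (X := X) hM hP κ hUP hUB
    simp only [hUstep] at h
    exact h
  have h2 : ∑ y ∈ periodBox (d := d) (M * N), ‖G y‖ ^ 2 ≤ 4 * ∑ y ∈ periodBox (d := d) (M * N), ‖F y‖ ^ 2 := by
    have hpt : ∀ y, ‖G y‖ ^ 2 ≤ 2 * ‖F y‖ ^ 2 + 2 * ‖tmean M N κ F y‖ ^ 2 := fun y => by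
      simp only [hGdef, Pi.sub_apply]
      have h := norm_sub_le (F y) (tmean M N κ F y)
      have h' : ‖F y - tmean M N κ F y‖ ^ 2 ≤ (‖F y‖ + ‖tmean M N κ F y‖) ^ 2 := by gcongr
      nlinarith [sq_nonneg (‖F y‖ - ‖tmean M N κ F y‖)]
    calc ∑ y ∈ periodBox (d := d) (M * N), ‖G y‖ ^ 2 ≤ ∑ y ∈ periodBox (d := d) (M * N), (2 * ‖F y‖ ^ 2 + 2 * ‖tmean M N κ F y‖ ^ 2) :=
          Finset.sum_le_sum fun y _ => hpt y
      _ = 2 * ∑ y ∈ periodBox (d := d) (M * N), ‖F y‖ ^ 2 + 2 * ∑ y ∈ periodBox (d := d) (M * N), ‖tmean M N κ F y‖ ^ 2 := by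
          rw [Finset.sum_add_distrib, Finset.mul_sum, Finset.mul_sum]
      _ ≤ 4 * ∑ y ∈ periodBox (d := d) (M * N), ‖F y‖ ^ 2 := by linear_combination 2 * sum_normSq_tmean_le hM hN κ hFP
  have h3 : ∑ y ∈ periodBox (d := d) (M * N), ‖(M : ℝ)⁻¹ • tmean M N κ F y‖ ^ 2 ≤ (1 / (M : ℝ)) ^ 2 * ∑ y ∈ periodBox (d := d) (M * N), ‖F y‖ ^ 2 := by
    have hM0 : (0 : ℝ) < M := by exact_mod_cast (by omega : 0 < M)
    have he : ∑ y ∈ periodBox (d := d) (M * N), ‖(M : ℝ)⁻¹ • tmean M N κ F y‖ ^ 2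
        = (1 / (M : ℝ)) ^ 2 * ∑ y ∈ periodBox (d := d) (M * N), ‖tmean M N κ F y‖ ^ 2 := by
      rw [Finset.mul_sum]
      refine Finset.sum_congr rfl fun y _ => ?_
      rw [norm_smul, mul_pow, Real.norm_eq_abs, abs_inv, abs_of_pos hM0, one_div]
    rw [he]
    exact mul_le_mul_of_nonneg_left (sum_normSq_tmean_le hM hN κ hFP) (by positivity)
  have hpt : ∀ y, ‖llift M N κ F y‖ ^ 2 ≤ 2 * ‖clift M κ U (y + e κ) - clift M κ U y‖ ^ 2 + 2 * ‖(M : ℝ)⁻¹ • tmean M N κ F y‖ ^ 2 := by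
    intro y
    have : llift M N κ F y = (clift M κ U (y + e κ) - clift M κ U y) + (M : ℝ)⁻¹ • tmean M N κ F y := rfl
    rw [this]
    have h := norm_add_le (clift M κ U (y + e κ) - clift M κ U y) ((M : ℝ)⁻¹ • tmean M N κ F y)
    have h' : ‖(clift M κ U (y + e κ) - clift M κ U y) + (M : ℝ)⁻¹ • tmean M N κ F y‖ ^ 2
        ≤ (‖clift M κ U (y + e κ) - clift M κ U y‖ + ‖(M : ℝ)⁻¹ • tmean M N κ F y‖) ^ 2 := by gcongr
    nlinarith [sq_nonneg (‖clift M κ U (y + e κ) - clift M κ U y‖ - ‖(M : ℝ)⁻¹ • tmean M N κ F y‖)]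
  calc ∑ y ∈ periodBox (d := d) (M * N), ‖llift M N κ F y‖ ^ 2
      ≤ ∑ y ∈ periodBox (d := d) (M * N), (2 * ‖clift M κ U (y + e κ) - clift M κ U y‖ ^ 2 + 2 * ‖(M : ℝ)⁻¹ • tmean M N κ F y‖ ^ 2) :=
        Finset.sum_le_sum fun y _ => hpt y
    _ = 2 * ∑ y ∈ periodBox (d := d) (M * N), ‖clift M κ U (y + e κ) - clift M κ U y‖ ^ 2
          + 2 * ∑ y ∈ periodBox (d := d) (M * N), ‖(M : ℝ)⁻¹ • tmean M N κ F y‖ ^ 2 := by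
        rw [Finset.sum_add_distrib, ← Finset.mul_sum, ← Finset.mul_sum]
    _ ≤ 1154 * (1 / (M : ℝ)) ^ 2 * ∑ y ∈ periodBox (d := d) (M * N), ‖F y‖ ^ 2 := by
        have h12 := mul_le_mul_of_nonneg_left h2 (by positivity : (0 : ℝ) ≤ 144 * (1 / (M : ℝ)) ^ 2)
        linear_combination 2 * h1 + 2 * h12 + 2 * h3

end Energy

end

end Summit.QuantumFields.BalabanUV.T4Continuum.NE7LongitudinalLineLiftEnergy
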